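import Summits.BirchSwinnertonDyer.Rank1Residual.X12.O11.RouteUTraceForm
import Literature.NumberTheory.EllipticCurves.QuadraticTwistKroneckerEvenLFunctionProofs
import Literature.NumberTheory.EllipticCurves.PAdicGrossZagierConstantTermProofs
import Literature.NumberTheory.QuadraticFields.FundamentalDiscriminant
import Literature.NumberTheory.QuadraticFields.KroneckerSplitting
import Literature.NumberTheory.QuadraticFields.ImaginaryQuadraticPrescribedSplitting
import HarnessLib

/-!
# ROUTE U, EVEN members `49a1^{(−4n)}` — the trace form `a_ℓ ≡ (−n/ℓ)(ℓ² + ℓ⁵) (mod 7)`, the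
# reduction away from `2·7·n`, and the Heegner prime `r ≡ 7 (mod 8)` (`2` splits in `ℚ(√−r)`)

bsd-cm cell (run/shared/lean/pub/bsd-cm/), ROUTE U (Theorem U: BSD(49a1^{(D)}, 7)), seat `bsd-cm-ram`
(g6). The even members of the O11 class at `7` are the twists `49a1^{(D)}`, `D = −4n` with
`n ≡ 1, 2 (mod 4)` squarefree, `7 ∤ n` (`n = 1, 2, 5, 6, 10, 13, 17, 22`). This file supplies, for
the even class theorem `RouteUEvenMember.bsdp_seven_of_twist_cm7_even`, what `RouteUTraceForm` /
`RouteUTwistReduction` / `RouteUQuadraticTwin` §2 gave for odd `D`: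

* §0 `−4n` is a fundamental discriminant;
* §1 `lFunction_twist_cm7_mod_seven_even` — `a_ℓ(W) ≡ (−n/ℓ)·(ℓ² + ℓ⁵) (mod 7)` for every prime
  `ℓ ≠ 7` and every model `W` of `49a1^{(−4n)}` (Kronecker twisting formula for the even
  discriminant `d_M = −4n`, tree `LFunction_quadraticTwist_apply_of_four_dvd_discr`, + (E49)
  `lFunction_cm7_mod_seven`); `hss_twist_cm7_even` — the `hss` binder of Kriz–Li Thm 1.20;
* §2 `hasGoodReductionAtPrime_of_twist_cm7_even` — good reduction at every odd `ℓ ∤ 7n`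
  (`hasGoodReductionAt_quadraticTwist`: odd place, `ℓ ∤ 2d`, `ℓ ∤ Δ_min(49a1) = −7³`); so every bad
  prime `ℓ ≠ 7` is `2` or divides `n` (`eq_two_or_dvd_of_not_hasGoodReductionAtPrime_twist_cm7_even`);
* §3 `ncard_primesOver_two_eq_two_of_mod_eight` — `2` splits in `ℚ(√−r)` for `r ≡ 7 (mod 8)`.

THEOREMS ONLY; no definitions, no named facts; nothing booked.
References: [KrizLi2019] Thm 1.20, §2; [SilvermanAEC2009] VII.5 Prop. 5.1, X.2 Ex. 10.16;
[Mazur1978] Prop. 6.3 (1); [Cox2013] Lemma 1.14, (1.18).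
-/

noncomputable section

open scoped Classical NumberTheorySymbols
open NumberField IsDedekindDomain WeierstrassCurve DirichletCharacter
open Literature.NumberTheory.EllipticCurves Literature.NumberTheory.EllipticCurves.Rank1Residual
open Literature.NumberTheory.EllipticCurves.KrizLi2019 Literature.NumberTheory.LFunctions
open Literature.NumberTheory.QuadraticFields

namespace Summit.BirchSwinnertonDyer.Rank1Residual.X12.O11.RouteU

/-! ## §0 `−4n` is a fundamental discriminant -/

/-- For `n ≡ 1, 2 (mod 4)` squarefree: `−4n` is a fundamental discriminant (`−n ≡ 3, 2 (mod 4)`).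
[cite: Cox2013, §1.C Lemma 1.14] -/
theorem isFundamental_neg_four_mul {n : ℕ} (hn4 : n % 4 = 1 ∨ n % 4 = 2) (hsq : Squarefree n) :
    ((-(4 * (n : ℤ))) % 4 = 1 ∧ Squarefree (-(4 * (n : ℤ))) ∧ (-(4 * (n : ℤ))) ≠ 1) ∨
      (4 ∣ (-(4 * (n : ℤ))) ∧ ((-(4 * (n : ℤ))) / 4 % 4 = 2 ∨ (-(4 * (n : ℤ))) / 4 % 4 = 3) ∧
        Squarefree ((-(4 * (n : ℤ))) / 4)) := by
  have hdiv : (-(4 * (n : ℤ))) / 4 = -(n : ℤ) := by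
    rw [show -(4 * (n : ℤ)) = 4 * (-(n : ℤ)) by ring, Int.mul_ediv_cancel_left _ (by norm_num)]
  refine Or.inr ⟨⟨-(n : ℤ), by ring⟩, ?_, ?_⟩
  · rw [hdiv]; omega
  · rw [hdiv, ← Int.squarefree_natAbs]; simpa using hsq

/-! ## §1 The trace form `a_ℓ(49a1^{(−4n)}) ≡ (−n/ℓ)(ℓ² + ℓ⁵) (mod 7)` and the `hss` binder -/

/-- **`a_ℓ(49a1^{(−4n)}) ≡ (−n/ℓ)·(ℓ² + ℓ⁵) (mod 7)`** for every prime `ℓ ≠ 7` (incl. `ℓ = 2`, where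
both sides vanish) and ANY model `W` of the quadratic twist of `49a1` by the EVEN fundamental
discriminant `−4n` (`n ≡ 1, 2 (mod 4)` squarefree, `7 ∤ n`): the Kronecker twisting formula
`a_m(E^{(d_M)}) = χ_{d_M}(m) a_m(E)` for `M = ℚ(√−n)`, `d_M = −4n`, `χ_{d_M}(m) = [m odd]·(−n/m)`
(tree `LFunction_quadraticTwist_apply_of_four_dvd_discr`; `49a1` is good at `2` and at the primes of
`n`), `LFunction_smul`, and (E49) `lFunction_cm7_mod_seven`.
[cite: SilvermanAEC2009, X.2 and Exercise 10.16] [cite: Mazur1978, Prop. 6.3 (1) (p. 153)] -/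
theorem lFunction_twist_cm7_mod_seven_even (W : WeierstrassCurve ℚ) [W.IsElliptic] {n : ℕ}
    (hn4 : n % 4 = 1 ∨ n % 4 = 2) (hsq : Squarefree n) (h7n : ¬ 7 ∣ n)
    (hW : ∃ C : VariableChange ℚ, C • W = cm7.quadraticTwist ((-(4 * (n : ℤ)) : ℤ) : ℚ))
    (ℓ : ℕ) [hℓ : Fact ℓ.Prime] (h7 : ℓ ≠ 7) :
    ((W.LFunction ℓ : ℤ) : ZMod 7) =
      ((if Even ℓ then (0 : ℤ) else J(-(n : ℤ) | ℓ) : ℤ) : ZMod 7) *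
        ((ℓ : ZMod 7) ^ 2 + (ℓ : ZMod 7) ^ 5) := by
  obtain ⟨C, hC⟩ := hW
  obtain ⟨M, _, _, hM2, hdM⟩ := Quadratic.exists_numberField_discr_eq (isFundamental_neg_four_mul hn4 hsq)
  have h4 : 4 ∣ NumberField.discr M := by rw [hdM]; exact ⟨-(n : ℤ), by ring⟩
  have hdiv : NumberField.discr M / 4 = -(n : ℤ) := by
    rw [hdM, show -(4 * (n : ℤ)) = 4 * (-(n : ℤ)) by ring, Int.mul_ediv_cancel_left _ (by norm_num)]
  have hgood : ∀ v : HeightOneSpectrum (𝓞 ℚ),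
      ((Rat.HeightOneSpectrum.primesEquiv v : ℕ) : ℤ) ∣ NumberField.discr M → cm7.HasGoodReductionAt v := by
    intro v hvD
    refine hasGoodReductionAt_cm7 fun h7v => h7n ?_
    have h := (DeuringLadic.natCast_mem_asIdeal_iff v 7).mp h7v
    have h7eq : (Rat.HeightOneSpectrum.primesEquiv v : ℕ) = 7 :=
      ((Nat.prime_dvd_prime_iff_eq (Rat.HeightOneSpectrum.primesEquiv v).2 (by norm_num)).mp h)
    rw [h7eq, hdM, dvd_neg] at hvD
    have h74 : ((7 : ℕ) : ℤ) ∣ (n : ℤ) :=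
      (Int.Prime.dvd_mul' (by norm_num) hvD).resolve_left (by norm_num)
    exact_mod_cast h74
  have h1 : W.LFunction ℓ = (cm7.quadraticTwist (NumberField.discr M : ℚ)).LFunction ℓ := by
    rw [hdM, ← hC, LFunction_smul]
  rw [h1, cm7.LFunction_quadraticTwist_apply_of_four_dvd_discr M hM2 h4 hgood ℓ, hdiv]
  push_cast
  rw [lFunction_cm7_mod_seven ℓ h7]

/-- **(U-ss) for the EVEN members, assembled**: for ANY model `W` of `49a1^{(−4n)}` (`n ≡ 1, 2 (mod 4)`
squarefree, `7 ∤ n`), a Teichmüller character `ω` mod `7` and a `ℚ₇`-valued character `ψ` with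
`ψ(ℓ) + ψ⁻¹(ℓ)ω(ℓ) = [ℓ odd]·(−n/ℓ)·(ω(ℓ)² + ω(ℓ)⁵)` at the primes `ℓ ∤ 7N_W`: the `hss` binder of
`KrizLi2019.thm120_padicLogHeegner_unit_of_bernoulli` holds. [cite: KrizLi2019, Thm. 1.20, Rem. 1.21 and §2] -/
theorem hss_twist_cm7_even (W : WeierstrassCurve ℚ) [W.IsElliptic] {n : ℕ}
    (hn4 : n % 4 = 1 ∨ n % 4 = 2) (hsq : Squarefree n) (h7n : ¬ 7 ∣ n)
    (hW : ∃ C : VariableChange ℚ, C • W = cm7.quadraticTwist ((-(4 * (n : ℤ)) : ℤ) : ℚ))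
    {f : ℕ} (ψ : DirichletCharacter ℚ_[7] f) (ω : DirichletCharacter ℚ_[7] 7)
    (hω : IsTeichmullerCharacter ω)
    (hψ : ∀ ℓ : ℕ, ℓ.Prime → ¬ (ℓ ∣ 7 * W.conductorNorm ℤ) →
      ψ (ℓ : ZMod f) + ψ⁻¹ (ℓ : ZMod f) * ω (ℓ : ZMod 7) =
        (((if Even ℓ then (0 : ℤ) else J(-(n : ℤ) | ℓ) : ℤ) : ℤ) : ℚ_[7]) *
          (ω (ℓ : ZMod 7) ^ 2 + ω (ℓ : ZMod 7) ^ 5)) :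
    ∀ ℓ : ℕ, ℓ.Prime → ¬ (ℓ ∣ 7 * W.conductorNorm ℤ) →
      ‖((W.LFunction ℓ : ℤ) : ℚ_[7]) -
        (ψ (ℓ : ZMod f) + ψ⁻¹ (ℓ : ZMod f) * ω (ℓ : ZMod 7))‖ < 1 := by
  refine hss_of_traceForm W ψ ω hω (fun ℓ => if Even ℓ then (0 : ℤ) else J(-(n : ℤ) | ℓ))
    (fun ℓ hℓ hℓN => ?_) hψ
  haveI : Fact ℓ.Prime := ⟨hℓ⟩
  have h7 : ℓ ≠ 7 := by rintro rfl; exact hℓN (dvd_mul_right 7 _)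
  exact lFunction_twist_cm7_mod_seven_even W hn4 hsq h7n hW ℓ h7

/-! ## §2 Reduction of `49a1^{(−4n)}` away from `2·7·n` -/

/-- **Good reduction of `49a1^{(−4n)}` at every odd prime `ℓ ∤ 7n`**: `49a1` is globally minimal
with `Δ_min = −7³`, so `ℓ ∤ Δ_min` for `ℓ ≠ 7`, and the twist by `d = −4n` is good at the odd place
`ℓ ∤ 2d` (tree `hasGoodReductionAt_quadraticTwist`); good reduction is invariant under `C`.
[cite: SilvermanAEC2009, VII.1 Remark 1.1 and VII.5 Prop. 5.1(a)] -/
theorem hasGoodReductionAtPrime_of_twist_cm7_even (W : WeierstrassCurve ℚ) [W.IsElliptic] {n : ℕ}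
    (hW : ∃ C : VariableChange ℚ, C • W = cm7.quadraticTwist ((-(4 * (n : ℤ)) : ℤ) : ℚ))
    (ℓ : ℕ) [hℓ : Fact ℓ.Prime] (h7 : ℓ ≠ 7) (hℓ2 : ℓ ≠ 2) (hℓn : ¬ ℓ ∣ n) :
    W.HasGoodReductionAtPrime ℓ := by
  obtain ⟨C, hC⟩ := hW
  haveI hmin7 : cm7.IsGloballyMinimal := isGloballyMinimal_X049_eq
  have hΔ : ¬ (ℓ : ℤ) ∣ minimalDiscriminantInt cm7 :=
    cm7.not_dvd_minimalDiscriminantInt_of_hasGoodReductionAtPrime ℓ (hasGoodReductionAtPrime_cm7 ℓ h7)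
  obtain ⟨v, rfl⟩ : ∃ v : HeightOneSpectrum (𝓞 ℚ), (Rat.HeightOneSpectrum.primesEquiv v : ℕ) = ℓ :=
    ⟨Rat.HeightOneSpectrum.primesEquiv.symm ⟨ℓ, hℓ.out⟩, by rw [Equiv.apply_symm_apply]⟩
  have h2d : ¬ ((Rat.HeightOneSpectrum.primesEquiv v : ℕ) : ℤ) ∣ 2 * (-(4 * (n : ℤ))) := by
    rw [show (2 : ℤ) * (-(4 * (n : ℤ))) = -((2 ^ 3 * n : ℕ) : ℤ) by push_cast; ring, dvd_neg,
      Int.natCast_dvd_natCast]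
    intro h
    rcases (Nat.Prime.dvd_mul hℓ.out).mp h with h8 | hn
    · exact hℓ2 ((Nat.prime_dvd_prime_iff_eq hℓ.out Nat.prime_two).mp (hℓ.out.dvd_of_dvd_pow h8))
    · exact hℓn hn
  have htw : (cm7.quadraticTwist (((-(4 * (n : ℤ))) : ℤ) : ℚ)).HasGoodReductionAt v :=
    cm7.hasGoodReductionAt_quadraticTwist v h2d hΔ
  have hCW : (C • W).HasGoodReductionAt v := by rw [hC]; exact htw
  have hWv : W.HasGoodReductionAt v := (hasGoodReductionAt_smul_iff_holds v W C).mp hCW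
  exact (hasGoodReductionAtPrime_iff_hasGoodReductionAt_ringOfIntegers v W).mpr hWv

/-- **Every bad prime `ℓ ≠ 7` of `49a1^{(−4n)}` is `2` or divides `n`** — the domain of Kriz–Li
Thm. 1.20 hypothesis (3) and of the Heegner hypothesis for the even members.
[cite: SilvermanAEC2009, VII.5 Prop. 5.1(a)] [cite: KrizLi2019, Thm. 1.20 (3) (p. 7)] -/
theorem eq_two_or_dvd_of_not_hasGoodReductionAtPrime_twist_cm7_even (W : WeierstrassCurve ℚ)
    [W.IsElliptic] {n : ℕ}
    (hW : ∃ C : VariableChange ℚ, C • W = cm7.quadraticTwist ((-(4 * (n : ℤ)) : ℤ) : ℚ))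
    (ℓ : ℕ) [Fact ℓ.Prime] (h7 : ℓ ≠ 7) (hbad : ¬ W.HasGoodReductionAtPrime ℓ) : ℓ = 2 ∨ ℓ ∣ n := by
  by_contra h
  rw [not_or] at h
  exact hbad (hasGoodReductionAtPrime_of_twist_cm7_even W hW ℓ h7 h.1 h.2)

/-! ## §3 The Heegner field `ℚ(√−r)`, `r ≡ 7 (mod 8)`: `2` splits -/

/-- **`2` splits in the imaginary quadratic field of discriminant `−r`, `r ≡ 7 (mod 8)`**
(`d_K = −r ≡ 1 (mod 8)`). [cite: Cox2013, §1.C Lemma 1.14 and (1.18)] -/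
theorem ncard_primesOver_two_eq_two_of_mod_eight {K : Type} [Field K] [NumberField K]
    (hK : IsImaginaryQuadratic K) {r : ℕ} (hdK : NumberField.discr K = -(r : ℤ)) (hr8 : r % 8 = 7) :
    ((Ideal.span {(2 : ℤ)}).primesOver (𝓞 K)).ncard = 2 := by
  rw [Quadratic.ncard_primesOver_two_eq_two_iff hK.1, hdK]
  omega

end Summit.BirchSwinnertonDyer.Rank1Residual.X12.O11.RouteU

end
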